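/-
Copyright (c) 2026 the pub-hodgecm-mathlib formalisation cell (harness21).  Prover seat hodgecm-mathlib-A-p19 (g21), D-T road (Tamagawa ∕ (K7-s)),
brick B2d «D-T3′-def, conjugation coherence and inversion invariance of the centraliser measure» (2026-09-01).
-/
import Literature.NumberTheory.Weil1964.UnitaryArchSingularCentralizerRationalFrames
import Literature.NumberTheory.Automorphic.ArchCentralizerUnimodularOfAdelic
import Literature.NumberTheory.Automorphic.UnitaryGroupOrbitalMeasureFamilyOfLocal
import Literature.NumberTheory.Automorphic.UnitaryGroupOfLocalTorusMeasure
import Literature.MeasureTheory.Group.InvariantQuotientOrbitalTransport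
import HarnessLib

/-!
# `centralizerTopFormHaar` is coherent under conjugation and inversion invariant — the two hypotheses of the point reading of a relative orbital-measure family
# (Rogawski 1990 §1.7 p. 6 «compatible measures», §3.8 Prop. 3.8.1 (a); Deitmar–Echterhoff Thm. 1.5.3)

Topic `NumberTheory/Weil1964`; namespace `Literature.NumberTheory.Weil1964.UnitaryArchTopForm`.  THEOREMS ONLY (no definition, no instance, no notation, no named fact,
no `sorry`) over ★ B2a–B2c `UnitaryArchSingularCentralizer{TopFormHaar,TopFormHaarFrames,RationalFrames}`, ★ `ArchCentralizerUnimodularOfAdelic`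
(`isMulRightInvariant_arch_centralizer_of_isSemisimpleElt`), ★ `UnitaryGroupOfLocalTorusMeasure` (`isInvInvariant_of_isMulRightInvariant_of_isClosed`), ★
`InvariantQuotientOrbitalTransport` ∕ `InvariantQuotientTransport` (`subgroupCongrHomeomorph`, `forall_apply_mem_centralizer_singleton_iff_of_eq`) and ★
`UnitaryGroupOrbitalMeasureFamilyOfLocal` (`continuous_mulAutConj(_symm)`).  Cell `pub/hodgecm-mathlib`, crux H413 = `stmt-HodgeConjecture-24833`; D-T road row «D-T3′»,
brick B2d.  PURPOSE: ★ `OrbitalMeasureFamily.IsQuotientOf.atPoint_eq_quotientMeasure_of_forall_map_conj_eq` (`Automorphic/OrbitalMeasureQuotientOfPoint` :181) reads a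
relative family `m.IsQuotientOf P ν t` AT A POINT provided (hP) `P` is conjugation-stable and (hcoh) `(conj q)|_* (t γ₁) = t γ₂` whenever `q γ₁ q⁻¹ = γ₂`; with
`P γ := ∃ frame of γ` and `t := centralizerTopFormHaar L H` both hypotheses are supplied here TOKEN-EXACT, so the (Q-∞) witness of the letter S1′ may take the top-form
centraliser measure as its datum `tGi` on the singular classes.

* `exists_isSingularArchFrame_conj` — (hP): frames transport along `γ ↦ q γ q⁻¹` (★ `IsSingularArchFrame.conj`).
* **`map_subgroupCongrHomeomorph_conj_centralizerTopFormHaar`** — (hcoh): `(conj q)|_* centralizerTopFormHaar γ₁ = centralizerTopFormHaar (q γ₁ q⁻¹)` (frame `T ↦ q T`;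
  `conj q ∘ (T · T⁻¹) = ((qT) · (qT)⁻¹)`; ★ `centralizerTopFormHaar_eq_centralizerMeasureOfFrame` in both frames).
* `isMulRightInvariant_centralizerTopFormHaar_cmRationalToArch`, **`isInvInvariant_centralizerTopFormHaar_cmRationalToArch`** — at `γ₀ ⊗ 1` for a singular semisimple
  non-scalar rational `γ₀` the measure is right and inversion invariant (the archimedean centraliser is unimodular, ★ §2 of `ArchCentralizerUnimodularOfAdelic`).
HONEST SCOPE.  Transport bookkeeping; HC_CM is proved only modulo the printed citations until rung 0 closes; this file discharges no printed statement.

## References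
* J. D. Rogawski, *Automorphic Representations of Unitary Groups in Three Variables*, Ann. of Math. Stud. 123 (1990), §1.7 p. 6, §3.8 Prop. 3.8.1 (a) p. 27. [Rogawski1990]
* A. Deitmar, S. Echterhoff, *Principles of Harmonic Analysis*, 2nd ed. (2014), Thm. 1.5.3. [DeitmarEchterhoff2014]
-/

set_option autoImplicit false

noncomputable section

open NumberField NumberField.mixedEmbedding NumberField.InfinitePlace Set Filter Topology MeasureTheory MeasureTheory.Measure
open Literature.NumberTheory.Automorphic Literature.NumberTheory.Automorphic.UnitaryGroup Literature.NumberTheory.Rogawski1990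
open Literature.MeasureTheory.Group
open scoped Classical Matrix MatrixGroups ENNReal NNReal

namespace Literature.NumberTheory.Weil1964

namespace UnitaryArchTopForm

section Coherence

variable {L : Type} [Field L] [NumberField L] [IsCMField L] {H : Matrix (Fin 3) (Fin 3) L}

/-- **(hP) Frames are conjugation-stable**: if `γ` admits a singular archimedean frame then so does `q γ q⁻¹` (★ `IsSingularArchFrame.conj`).
[cite: Rogawski1990, §3.8 Prop. 3.8.1 (a) p. 27] -/
theorem exists_isSingularArchFrame_conj (γ q : arch (↥(maximalRealSubfield L)) L (IsCMField.complexConj L) 3 H)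
    (h : ∃ (a b : L) (T : GL (Fin 3) (mixedSpace L)) (H_a : Matrix (Fin 2) (Fin 2) L) (H_b : Matrix (Fin 1) (Fin 1) L), IsSingularArchFrame L H γ a b T H_a H_b) :
    ∃ (a b : L) (T : GL (Fin 3) (mixedSpace L)) (H_a : Matrix (Fin 2) (Fin 2) L) (H_b : Matrix (Fin 1) (Fin 1) L),
      IsSingularArchFrame L H (q * γ * q⁻¹) a b T H_a H_b := by
  obtain ⟨a, b, T, Ha, Hb, hf⟩ := h
  exact ⟨a, b, _, Ha, Hb, hf.conj q⟩

variable [MeasurableSpace (arch (↥(maximalRealSubfield L)) L (IsCMField.complexConj L) 3 H)] [BorelSpace (arch (↥(maximalRealSubfield L)) L (IsCMField.complexConj L) 3 H)]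

/-- **(hcoh) CONJUGATION COHERENCE OF `centralizerTopFormHaar`**: for `q ∈ U(H)(L⁺ ⊗ ℝ)` with `q γ₁ q⁻¹ = γ₂` and `γ₁` framed, the conjugation homeomorphism
`Z(γ₁) ≃ₜ Z(γ₂)` (★ `subgroupCongrHomeomorph (MulAut.conj q)`) carries `centralizerTopFormHaar γ₁` to `centralizerTopFormHaar γ₂` — a frame `T` of `γ₁` gives the
frame `q T` of `γ₂`, `conj q ∘ (T · T⁻¹) = (qT) · (qT)⁻¹` on the block product, and the definition is frame-independent (★ `centralizerTopFormHaar_eq_centralizerMeasureOfFrame`).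
The statement is the `hcoh` binder of ★ `OrbitalMeasureFamily.IsQuotientOf.atPoint_eq_quotientMeasure_of_forall_map_conj_eq`, token for token.
[cite: Rogawski1990, §1.7 p. 6; §3.8 Prop. 3.8.1 (a) p. 27] [cite: DeitmarEchterhoff2014, Thm. 1.5.3] -/
theorem map_subgroupCongrHomeomorph_conj_centralizerTopFormHaar {γ₁ γ₂ : arch (↥(maximalRealSubfield L)) L (IsCMField.complexConj L) 3 H}
    (q : arch (↥(maximalRealSubfield L)) L (IsCMField.complexConj L) 3 H)
    (hq : (MulAut.conj q : arch (↥(maximalRealSubfield L)) L (IsCMField.complexConj L) 3 H ≃* arch (↥(maximalRealSubfield L)) L (IsCMField.complexConj L) 3 H) γ₁ = γ₂)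
    (hγ₁ : ∃ (a b : L) (T : GL (Fin 3) (mixedSpace L)) (H_a : Matrix (Fin 2) (Fin 2) L) (H_b : Matrix (Fin 1) (Fin 1) L), IsSingularArchFrame L H γ₁ a b T H_a H_b) :
    Measure.map (subgroupCongrHomeomorph (MulAut.conj q : arch (↥(maximalRealSubfield L)) L (IsCMField.complexConj L) 3 H ≃* arch (↥(maximalRealSubfield L)) L (IsCMField.complexConj L) 3 H)
        (Subgroup.centralizer ({γ₁} : Set (arch (↥(maximalRealSubfield L)) L (IsCMField.complexConj L) 3 H)))
        (Subgroup.centralizer ({γ₂} : Set (arch (↥(maximalRealSubfield L)) L (IsCMField.complexConj L) 3 H)))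
        (forall_apply_mem_centralizer_singleton_iff_of_eq
          (MulAut.conj q : arch (↥(maximalRealSubfield L)) L (IsCMField.complexConj L) 3 H ≃* arch (↥(maximalRealSubfield L)) L (IsCMField.complexConj L) 3 H) hq)
        (continuous_mulAutConj q) (continuous_mulAutConj_symm q))
      (centralizerTopFormHaar L H γ₁) = centralizerTopFormHaar L H γ₂ := by
  obtain ⟨a, b, T, Ha, Hb, h₁⟩ := hγ₁
  have h₂ : IsSingularArchFrame L H γ₂ a b ((q : GL (Fin 3) (mixedSpace L)) * T) Ha Hb := by
    rw [← hq, MulAut.conj_apply]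
    exact h₁.conj q
  letI : MeasurableSpace (arch (↥(maximalRealSubfield L)) L (IsCMField.complexConj L) 2 Ha) := borel _
  haveI : BorelSpace (arch (↥(maximalRealSubfield L)) L (IsCMField.complexConj L) 2 Ha) := ⟨rfl⟩
  letI : MeasurableSpace (archSkew (↥(maximalRealSubfield L)) L (IsCMField.complexConj L) 2 Ha) := borel _
  haveI : BorelSpace (archSkew (↥(maximalRealSubfield L)) L (IsCMField.complexConj L) 2 Ha) := ⟨rfl⟩
  letI : MeasurableSpace (arch (↥(maximalRealSubfield L)) L (IsCMField.complexConj L) 1 Hb) := borel _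
  haveI : BorelSpace (arch (↥(maximalRealSubfield L)) L (IsCMField.complexConj L) 1 Hb) := ⟨rfl⟩
  letI : MeasurableSpace (archSkew (↥(maximalRealSubfield L)) L (IsCMField.complexConj L) 1 Hb) := borel _
  haveI : BorelSpace (archSkew (↥(maximalRealSubfield L)) L (IsCMField.complexConj L) 1 Hb) := ⟨rfl⟩
  haveI : BorelSpace (arch (↥(maximalRealSubfield L)) L (IsCMField.complexConj L) 2 Ha × arch (↥(maximalRealSubfield L)) L (IsCMField.complexConj L) 1 Hb) :=
    Prod.borelSpace
  rw [centralizerTopFormHaar_eq_centralizerMeasureOfFrame h₁, centralizerTopFormHaar_eq_centralizerMeasureOfFrame h₂, centralizerMeasureOfFrame_def,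
    centralizerMeasureOfFrame_def]
  have hmeas₁ : Measurable (fun u : arch (↥(maximalRealSubfield L)) L (IsCMField.complexConj L) 2 Ha × arch (↥(maximalRealSubfield L)) L (IsCMField.complexConj L) 1 Hb =>
      (⟨archFrameEmbedding (N₁ := 2) (N₂ := 1) T h₁.formCongr_eq u, archFrameEmbedding_mem_centralizer (N₁ := 2) (N₂ := 1) T h₁.formCongr_eq γ₁ h₁.mul_eq u⟩ :
        Subgroup.centralizer ({γ₁} : Set (arch (↥(maximalRealSubfield L)) L (IsCMField.complexConj L) 3 H)))) :=
    ((continuous_archFrameEmbedding (N₁ := 2) (N₂ := 1) T h₁.formCongr_eq).subtype_mk _).measurable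
  rw [Measure.map_map (Homeomorph.measurable _) hmeas₁]
  congr 1
  funext u
  apply Subtype.ext
  rw [Function.comp_apply, coe_subgroupCongrHomeomorph_apply, MulAut.conj_apply]
  apply Subtype.ext
  rw [coe_archFrameEmbedding, Subgroup.coe_mul, Subgroup.coe_mul, Subgroup.coe_inv, coe_archFrameEmbedding, mul_inv_rev]
  simp only [mul_assoc]

/-- **`centralizerTopFormHaar (γ₀ ⊗ 1)` IS RIGHT INVARIANT** for a singular semisimple non-scalar rational `γ₀` (the archimedean centraliser is unimodular: ★
`isMulRightInvariant_arch_centralizer_of_isSemisimpleElt`). [cite: Rogawski1990, §3.8 Prop. 3.8.1 (a) p. 27] -/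
theorem isMulRightInvariant_centralizerTopFormHaar_cmRationalToArch (hH : (H.map (cmConjRingHom L))ᵀ = H) (hdet : H.det ≠ 0)
    (γ₀ : (cmDatum L 3 H).Rational) (hss : Rogawski1990.IsSemisimpleElt (cmConjRingHom L) H γ₀) (hnreg : ¬ IsRegularElt (γ₀.val : GL (Fin 3) L))
    (hnsc : ∀ ζ : L, ((γ₀.val : GL (Fin 3) L) : Matrix (Fin 3) (Fin 3) L) ≠ ζ • 1) :
    (centralizerTopFormHaar L H (cmRationalToArch L 3 H γ₀)).IsMulRightInvariant := by
  haveI := isHaarMeasure_centralizerTopFormHaar_cmRationalToArch hH hdet γ₀ hss hnreg hnsc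
  exact isMulRightInvariant_arch_centralizer_of_isSemisimpleElt hH hdet γ₀ hss _

/-- **`centralizerTopFormHaar (γ₀ ⊗ 1)` IS INVERSION INVARIANT** for a singular semisimple non-scalar rational `γ₀` (Haar + right invariant on the closed
subgroup `Z(γ₀ ⊗ 1)`: ★ `isInvInvariant_of_isMulRightInvariant_of_isClosed`) — the `IsInvInvariant` conjunct the point reading of an `IsQuotientOf` family returns.
[cite: Rogawski1990, §1.7 p. 6; §3.8 Prop. 3.8.1 (a) p. 27] [cite: DeitmarEchterhoff2014, Thm. 1.5.3] -/
theorem isInvInvariant_centralizerTopFormHaar_cmRationalToArch (hH : (H.map (cmConjRingHom L))ᵀ = H) (hdet : H.det ≠ 0)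
    (γ₀ : (cmDatum L 3 H).Rational) (hss : Rogawski1990.IsSemisimpleElt (cmConjRingHom L) H γ₀) (hnreg : ¬ IsRegularElt (γ₀.val : GL (Fin 3) L))
    (hnsc : ∀ ζ : L, ((γ₀.val : GL (Fin 3) L) : Matrix (Fin 3) (Fin 3) L) ≠ ζ • 1) :
    (centralizerTopFormHaar L H (cmRationalToArch L 3 H γ₀)).IsInvInvariant := by
  haveI := isHaarMeasure_centralizerTopFormHaar_cmRationalToArch hH hdet γ₀ hss hnreg hnsc
  haveI := isMulRightInvariant_centralizerTopFormHaar_cmRationalToArch hH hdet γ₀ hss hnreg hnsc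
  exact isInvInvariant_of_isMulRightInvariant_of_isClosed _ (Set.isClosed_centralizer _) _

end Coherence

end UnitaryArchTopForm

end Literature.NumberTheory.Weil1964

end
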